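import Literature.NumberTheory.GaloisRepresentations.ContinuousCohomologyConnecting
import Literature.NumberTheory.GaloisRepresentations.ContinuousCorestriction
import HarnessLib

/-!
# `cor ∘ H¹(f) ∘ res = H¹(N f)`: the projection formula for an `H`-equivariant coefficient map

Topic `NumberTheory/GaloisRepresentations`; namespace `Literature.NumberTheory.GaloisRepresentations`.
Cell `bsd-smallim` (rung K6 of `BirchSwinnertonDyer`, crux `MuTransferX9` = item 19276), seat
`bsd-smallim-k6-ty` (typer): the generic half of the Shapiro-dictionary entry
"`res_{K_n → K_m} ↔ T^{p^m − p^n}`-embedding" (`IwasawaTwistModPShapiroCores.lean`: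
`coresShapiro m (res y) = cor_{Γ_n}^{Γ} (cor_{Γ_m}^{Γ_n} (H¹(ι_m) (res y)))`, and the inner term is
`H¹(N ι_m) y` by the present file).  PROOFS and definitions with bodies; no fact.

For subgroups `H ≤ H'` of a topological group `G` (`H` open, of finite index in `H'`), topological
`G`-representations `X, Y` and a morphism `f : X|_H ⟶ Y|_H` of `H`-representations:
* `normConj f a = a · f · a⁻¹ : X →+ Y` (`a ∈ G`), constant on cosets `aH` (`normConj_mul_of_mem`);
* `normFun f s = Σ_{x ∈ H'/H} s(x) · f · s(x)⁻¹` and the morphism of `H'`-representations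
  **`normRepHom f hs : X|_{H'} ⟶ Y|_{H'}`** ("norm" / trace of `f`, `N_{H'/H} f`);
* **`coresLe_cohomologyMap_resLe`**: `cor_{H'/H} (H¹(f) (res_{H/H'} c)) = H¹(N_{H'/H} f) c` in
  `H¹(H', Y)` for every `c ∈ H¹(H', X)` — on cocycles the transfer of `f ∘ φ|_H` is
  `h' ↦ (N f)(φ h') + h'·w − w`, `w = Σ_x (s(x)·f·s(x)⁻¹)(φ(s x))`.
  (For `f = id` this is `cor ∘ res = (H' : H)`, `cores_resSubgroup`.)

## References

* J. Neukirch, A. Schmidt, K. Wingberg, *Cohomology of Number Fields* (2008), I §5, Prop. 1.5.3 (iv)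
  and (1.5.4) (the projection formula / `cor ∘ res`). [NeukirchSchmidtWingberg2008]
* J.-P. Serre, *Galois Cohomology* (1997), I §2.4–§2.5. [SerreGaloisCohomology1997]
-/

noncomputable section

open CategoryTheory

universe u w

namespace Literature.NumberTheory.GaloisRepresentations

open Literature.NumberTheory.EllipticCurves (schreierElt schreierElt_coe subgroupInclusion)

variable {k : Type w} [CommRing k] [TopologicalSpace k]
variable {G : Type u} [Group G] [TopologicalSpace G] [IsTopologicalGroup G]
variable {X Y : TopRep.{u} k G} {H H' : Subgroup G}

/-! ## The conjugates `a · f · a⁻¹` and the norm `N_{H'/H} f` of an `H`-morphism -/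

section Norm

variable (f : subgroupRep X H ⟶ subgroupRep Y H)

/-- The conjugate `a · f · a⁻¹ : X →+ Y` (`v ↦ a • f(a⁻¹ • v)`) of an `H`-morphism `f : X|_H ⟶ Y|_H`
by `a ∈ G`. [cite: NeukirchSchmidtWingberg2008, I §5 (1.5.4)] -/
def normConj (a : G) : X →+ Y :=
  (Y.ρ a).toLinearMap.toAddMonoidHom.comp
    (f.hom.toContinuousLinearMap.toLinearMap.toAddMonoidHom.comp (X.ρ a⁻¹).toLinearMap.toAddMonoidHom)

omit [TopologicalSpace G] [IsTopologicalGroup G] in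
/-- Unfolding `normConj`. [cite: NeukirchSchmidtWingberg2008, I §5 (1.5.4)] -/
@[simp] theorem normConj_apply (a : G) (v : X) : normConj f a v = Y.ρ a (f.hom (X.ρ a⁻¹ v)) := rfl

omit [TopologicalSpace G] [IsTopologicalGroup G] in
/-- `f` is `H`-equivariant (elements of `G` lying in `H`). [cite: NeukirchSchmidtWingberg2008, I §5 (1.5.4)] -/
theorem hom_ρ_apply_of_mem {n : G} (hn : n ∈ H) (v : X) : f.hom (X.ρ n v) = Y.ρ n (f.hom v) :=
  TopRep.hom_comm_apply f ⟨n, hn⟩ v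

omit [TopologicalSpace G] [IsTopologicalGroup G] in
/-- `a · f · a⁻¹` only depends on the coset `aH`. [cite: NeukirchSchmidtWingberg2008, I §5 (1.5.4)] -/
theorem normConj_mul_of_mem (a : G) {n : G} (hn : n ∈ H) : normConj f (a * n) = normConj f a := by
  ext v
  rw [normConj_apply, normConj_apply, mul_inv_rev, ρ_mul_apply, ρ_mul_apply,
    hom_ρ_apply_of_mem f (H.inv_mem hn), ρ_apply_ρ_inv_apply]

omit [TopologicalSpace G] [IsTopologicalGroup G] in
/-- `a · f · a⁻¹ = b · f · b⁻¹` for `a, b ∈ H'` in the same coset of `H`.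
[cite: NeukirchSchmidtWingberg2008, I §5 (1.5.4)] -/
theorem normConj_eq_of_coe_eq {a b : H'} (hab : (a : H' ⧸ H.subgroupOf H') = b) :
    normConj f (a : G) = normConj f (b : G) := by
  obtain ⟨n, hn, rfl⟩ : ∃ n : H', n ∈ H.subgroupOf H' ∧ b = a * n :=
    ⟨a⁻¹ * b, QuotientGroup.eq.1 hab, (mul_inv_cancel_left a b).symm⟩
  rw [Subgroup.coe_mul, normConj_mul_of_mem f _ (Subgroup.mem_subgroupOf.1 hn)]

omit [TopologicalSpace G] [IsTopologicalGroup G] in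
/-- Moving a group element through a conjugate: `(a·f·a⁻¹)(g • v) = g • ((g⁻¹a)·f·(g⁻¹a)⁻¹)(v)`.
[cite: NeukirchSchmidtWingberg2008, I §5 (1.5.4)] -/
theorem normConj_ρ_apply (a g : G) (v : X) :
    normConj f a (X.ρ g v) = Y.ρ g (normConj f (g⁻¹ * a) v) := by
  rw [normConj_apply, normConj_apply, ← ρ_mul_apply, ← ρ_mul_apply, mul_inv_rev, inv_inv,
    mul_inv_cancel_left]

variable [Fintype (H' ⧸ H.subgroupOf H')]

/-- The norm `N_s f = Σ_{x ∈ H'/H} s(x) · f · s(x)⁻¹ : X → Y` of an `H`-morphism with respect to a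
system of representatives `s` of `H' ⧸ H`. [cite: NeukirchSchmidtWingberg2008, I §5 (1.5.4)] -/
def normFun (s : H' ⧸ H.subgroupOf H' → H') (v : X) : Y := ∑ x, normConj f (s x : G) v

omit [TopologicalSpace G] [IsTopologicalGroup G] in
/-- Unfolding `normFun`. [cite: NeukirchSchmidtWingberg2008, I §5 (1.5.4)] -/
theorem normFun_apply (s : H' ⧸ H.subgroupOf H' → H') (v : X) :
    normFun f s v = ∑ x, normConj f (s x : G) v := rfl

variable {s : H' ⧸ H.subgroupOf H' → H'}

omit [TopologicalSpace G] [IsTopologicalGroup G] [Fintype (H' ⧸ H.subgroupOf H')] in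
/-- Reindexing the conjugates: `(h'⁻¹ s(h'•x)) · f · (…)⁻¹ = s(x) · f · s(x)⁻¹`.
[cite: NeukirchSchmidtWingberg2008, I §5 (1.5.4)] -/
theorem normConj_inv_mul_rep (hs : ∀ x, (s x : H' ⧸ H.subgroupOf H') = x) (h' : H')
    (x : H' ⧸ H.subgroupOf H') :
    normConj f ((h' : G)⁻¹ * (s (h' • x) : G)) = normConj f (s x : G) := by
  have h1 : ((h' : G)⁻¹ * (s (h' • x) : G)) = ((h'⁻¹ * s (h' • x) : H') : G) := rfl
  rw [h1]
  refine normConj_eq_of_coe_eq f ?_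
  rw [hs, ← smul_eq_mul, ← MulAction.Quotient.smul_coe, hs, inv_smul_smul]

omit [TopologicalSpace G] [IsTopologicalGroup G] in
/-- **`N_s f` is `H'`-equivariant**: `N(h' • v) = h' • N(v)` (reindex the cosets by `x ↦ h'⁻¹ • x`).
[cite: NeukirchSchmidtWingberg2008, I §5 (1.5.4)] -/
theorem normFun_ρ_apply (hs : ∀ x, (s x : H' ⧸ H.subgroupOf H') = x) (h' : H') (v : X) :
    normFun f s (X.ρ (h' : G) v) = Y.ρ (h' : G) (normFun f s v) := by
  rw [normFun_apply, normFun_apply, map_sum]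
  refine Fintype.sum_equiv (MulAction.toPerm h'⁻¹) _ _ fun x ↦ ?_
  rw [MulAction.toPerm_apply, normConj_ρ_apply]
  congr 2
  have hx : s x = s (h' • (h'⁻¹ • x)) := by rw [smul_inv_smul]
  rw [hx, normConj_inv_mul_rep f hs]

omit [TopologicalSpace G] [IsTopologicalGroup G] in
/-- `N_s f` is continuous. [cite: NeukirchSchmidtWingberg2008, I §5 (1.5.4)] -/
theorem continuous_normFun (s : H' ⧸ H.subgroupOf H' → H') : Continuous (normFun f s) := by
  unfold normFun
  refine continuous_finsetSum _ fun x _ ↦ ?_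
  exact (Y.ρ _).continuous.comp (f.hom.toContinuousLinearMap.continuous.comp (X.ρ _).continuous)

/-- **The norm `N_{H'/H} f : X|_{H'} ⟶ Y|_{H'}`** of an `H`-morphism `f : X|_H ⟶ Y|_H`
(`Σ_{x ∈ H'/H} s(x)·f·s(x)⁻¹`), a morphism of topological `H'`-representations.
[cite: NeukirchSchmidtWingberg2008, I §5 (1.5.4)] -/
def normRepHom (hs : ∀ x, (s x : H' ⧸ H.subgroupOf H') = x) : subgroupRep X H' ⟶ subgroupRep Y H' :=
  TopRep.ofHom
    ⟨{ toFun := normFun f s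
       map_add' := fun v w ↦ by
         simp only [normFun_apply, map_add, Finset.sum_add_distrib]
       map_smul' := fun c v ↦ by
         simp only [normFun_apply, RingHom.id_apply, Finset.smul_sum]
         refine Finset.sum_congr rfl fun x _ ↦ ?_
         rw [normConj_apply, normConj_apply, map_smul, map_smul, map_smul]
       cont := continuous_normFun f s },
      fun h' ↦ ContinuousLinearMap.ext fun v ↦ normFun_ρ_apply f hs h' v⟩

omit [TopologicalSpace G] [IsTopologicalGroup G] in
/-- `N_{H'/H} f` on elements. [cite: NeukirchSchmidtWingberg2008, I §5 (1.5.4)] -/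
@[simp] theorem normRepHom_hom_apply (hs : ∀ x, (s x : H' ⧸ H.subgroupOf H') = x) (v : X) :
    (normRepHom f hs).hom v = ∑ x, normConj f (s x : G) v := rfl

end Norm

/-! ## The projection formula `cor ∘ H¹(f) ∘ res = H¹(N f)` -/

/-- **`cor_{H'/H} ∘ H¹(f) ∘ res_{H/H'} = H¹(N_{H'/H} f)` on `H¹(H', X)`** for an `H`-morphism
`f : X|_H ⟶ Y|_H` (`H ≤ H'`, `H` open of finite index in `H'`).  On cocycles: the transfer of
`f ∘ φ|_H` at `h'` is `Σ_x s(h'x)·f(φ(s(h'x)⁻¹ h' s(x))) = (N f)(φ h') + h'·w − w` with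
`w = Σ_x (s(x)·f·s(x)⁻¹)(φ(s x))` (expand `φ(a⁻¹ h' b)` by the cocycle rule and reindex twice by
`x ↦ h'•x`). [cite: NeukirchSchmidtWingberg2008, I §5 Prop. 1.5.3 (iv)]
[cite: SerreGaloisCohomology1997, I §2.4] -/
theorem coresLe_cohomologyMap_resLe (h : H ≤ H') (hH : IsOpen (H : Set G))
    [Fintype (H' ⧸ H.subgroupOf H')] {s : H' ⧸ H.subgroupOf H' → H'}
    (hs : ∀ x, (s x : H' ⧸ H.subgroupOf H') = x) (f : subgroupRep X H ⟶ subgroupRep Y H)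
    (c : continuousCohomology 1 (subgroupRep X H')) :
    coresLe Y h hH (cohomologyMap f 1 (resLe X h 1 c)) = cohomologyMap (normRepHom f hs) 1 c := by
  classical
  obtain ⟨φ, rfl⟩ := oneCocycleClass_surjective _ c
  rw [resLe_oneCocycleClass, cohomologyMap_oneCocycleClass, coresLe_oneCocycleClass Y h hH hs,
    cohomologyMap_oneCocycleClass, ← sub_eq_zero, ← oneCocycleClass_sub, oneCocycleClass_eq_zero_iff]
  refine ⟨∑ x, normConj f (s x : G) (φ.1 (s x)), fun h' ↦ ?_⟩
  rw [Submodule.coe_sub, ContinuousMap.sub_apply, transferCocycle_apply, transferFun_apply,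
    pullback_id_resIdHom_apply, normRepHom_hom_apply, subgroupRep_ρ_apply]
  -- the summands of the transfer
  have key : ∀ x : H' ⧸ H.subgroupOf H',
      (subgroupRep Y H').ρ (s (h' • x))
          ((contOneCocycles.pullback (subgroupOfHom h)
              (Y := subgroupRep (subgroupRep Y H') (H.subgroupOf H'))
              (TopRep.ofHom ⟨ContinuousLinearMap.id k Y, fun _ => rfl⟩)
              (contOneCocycles.pullback (ContinuousMonoidHom.id _) (resIdHom f)
                (contOneCocycles.pullback (subgroupInclusion h)
                  (TopRep.ofHom ⟨ContinuousLinearMap.id k X, fun _ => rfl⟩) φ))).1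
            (schreierElt (H.subgroupOf H') hs h' x)) =
        normConj f (s (h' • x) : G) (φ.1 h') +
          (Y.ρ (h' : G) (normConj f (s x : G) (φ.1 (s x))) -
            normConj f (s (h' • x) : G) (φ.1 (s (h' • x)))) := fun x ↦ by
    have hval : (contOneCocycles.pullback (subgroupOfHom h)
        (Y := subgroupRep (subgroupRep Y H') (H.subgroupOf H'))
        (TopRep.ofHom ⟨ContinuousLinearMap.id k Y, fun _ => rfl⟩)
        (contOneCocycles.pullback (ContinuousMonoidHom.id _) (resIdHom f)
          (contOneCocycles.pullback (subgroupInclusion h)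
            (TopRep.ofHom ⟨ContinuousLinearMap.id k X, fun _ => rfl⟩) φ))).1
          (schreierElt (H.subgroupOf H') hs h' x) =
        f.hom (φ.1 ((s (h' • x))⁻¹ * (h' * s x))) := by
      rw [← mul_assoc]; rfl
    rw [hval, subgroupRep_ρ_apply, subgroup_cocycle_mul, subgroup_cocycle_inv, subgroup_cocycle_mul,
      Subgroup.coe_inv, ← map_neg (X.ρ ((s (h' • x) : G))⁻¹), ← map_add (X.ρ ((s (h' • x) : G))⁻¹),
      ← normConj_apply f, map_add, map_neg, map_add, normConj_ρ_apply f _ (h' : G),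
      normConj_inv_mul_rep f hs]
    abel
  rw [Finset.sum_congr rfl fun x _ ↦ key x, Finset.sum_add_distrib, Finset.sum_sub_distrib, ← map_sum]
  -- reindex the two sums over `h' • x`
  have hre : ∀ F : H' ⧸ H.subgroupOf H' → Y, ∑ x, F (h' • x) = ∑ x, F x := fun F ↦
    Fintype.sum_equiv (MulAction.toPerm h') _ _ fun _ ↦ rfl
  rw [hre (fun x ↦ normConj f (s x : G) (φ.1 h')), hre (fun x ↦ normConj f (s x : G) (φ.1 (s x)))]
  abel

end Literature.NumberTheory.GaloisRepresentations

end
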